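import Mathlib.Algebra.Module.ZMod
import Mathlib.GroupTheory.SpecificGroups.Cyclic
import Mathlib.GroupTheory.Index
import HarnessLib

/-!
# Serre 1972, §1.11 (1): the line `X_p` of an ordinary reduction — the module-theoretic skeleton

Topic `NumberTheory/EllipticCurves`.  Theorems only (nothing is defined, no named fact).  In
J.-P. Serre, *Propriétés galoisiennes des points d'ordre fini des courbes elliptiques*, Invent.
Math. 15 (1972), §1.11 (1) (good reduction of height `1`), the `I`-module structure of `E_p` is read
off the reduction sequence `0 → X_p → E_p → Ẽ_p → 0`: "le noyau `X_p` est cyclique d'ordre `p`.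
Le groupe `G` laisse stable `X_p` … `χ_Y = 1` résulte de ce que `G` opère sur `Ẽ_p` par
l'intermédiaire de … l'action naturelle de `G_k` sur `Ẽ(k̄)`" (so the inertia group acts
trivially on `Ẽ_p`).  This file isolates the purely module-theoretic part of that deduction, in
the shape consumed by the local hypothesis `hF` of
`Literature.NumberTheory.EllipticCurves.serre_open_image_of_reduction_shape`
(`SerreOpenImageOfLocalInputProofs`): for an `𝔽_ℓ`-plane `A` (`#A = ℓ²`), a homomorphism
`f : A → B` ("reduction") which is invariant under a family of additive maps `τ` ("inertia acts
trivially on the reduction") and does not vanish identically on `A` ("ordinary: some `ℓ`-torsion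
point has non-zero reduction"), there is `v₀ ≠ 0` with `τ x - x ∈ 𝔽_ℓ v₀` for all `τ`, `x`
(`exists_forall_sub_mem_line_of_invariant`).  What remains arithmetic is the reduction map on
`E[ℓ]`, its inertia invariance, and its non-vanishing at an ordinary prime.

* `Literature.NumberTheory.EllipticCurves.exists_forall_eq_smul_of_card_le` — a subgroup of
  order `≤ ℓ` of an `𝔽_ℓ`-module lies on a line through a non-zero vector (if the module is not
  trivial).
* `Literature.NumberTheory.EllipticCurves.card_ker_le_of_exists_ne_zero` — for `f : A →+ B` on an
  `𝔽_ℓ`-plane not identically zero, `#ker f ≤ ℓ`.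
* `Literature.NumberTheory.EllipticCurves.exists_forall_sub_mem_line_of_invariant` — the skeleton.

## References

* [Serre1972] J.-P. Serre, Invent. Math. 15 (1972) 259–331, §1.11 (1), Prop. 11 and its proof.
-/

namespace Literature.NumberTheory.EllipticCurves

variable {ℓ : ℕ} [Fact ℓ.Prime] {A : Type*} [AddCommGroup A] [Module (ZMod ℓ) A]

/-- A non-zero element of an `𝔽_ℓ`-module (`ℓ` prime) has additive order `ℓ`. [folklore] -/
theorem addOrderOf_eq_prime_of_ne_zero {v₀ : A} (hv₀ : v₀ ≠ 0) : addOrderOf v₀ = ℓ := by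
  have hp : ℓ.Prime := Fact.out
  have hℓ : ℓ • v₀ = 0 := by
    rw [← Nat.cast_smul_eq_nsmul (ZMod ℓ), ZMod.natCast_self, zero_smul]
  exact ((Nat.dvd_prime hp).mp (addOrderOf_dvd_of_nsmul_eq_zero hℓ)).resolve_left
    fun h ↦ hv₀ (AddMonoid.addOrderOf_eq_one_iff.mp h)

/-- **A subgroup of order `≤ ℓ` of an `𝔽_ℓ`-module lies on a line**: if `#X ≤ ℓ` (and `A ≠ 0`)
there is `v₀ ≠ 0` with `X ⊆ 𝔽_ℓ v₀` ("le noyau `X_p` est cyclique d'ordre `p`").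
[cite: Serre1972, §1.11 (1)] -/
theorem exists_forall_eq_smul_of_card_le (X : AddSubgroup A) [Finite X] (hX : Nat.card X ≤ ℓ)
    (hA : ∃ a : A, a ≠ 0) : ∃ v₀ : A, v₀ ≠ 0 ∧ ∀ x ∈ X, ∃ b : ZMod ℓ, x = b • v₀ := by
  by_cases h0 : ∀ x ∈ X, x = 0
  · obtain ⟨a, ha⟩ := hA
    exact ⟨a, ha, fun x hx ↦ ⟨0, by rw [h0 x hx, zero_smul]⟩⟩
  · push Not at h0
    obtain ⟨v₀, hv₀X, hv₀⟩ := h0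
    refine ⟨v₀, hv₀, ?_⟩
    -- `𝔽_ℓ v₀ = ℤ v₀ ≤ X` has `ℓ ≥ #X` elements, so equality
    have hle : AddSubgroup.zmultiples v₀ ≤ X := AddSubgroup.zmultiples_le.mpr hv₀X
    have hcard : Nat.card (AddSubgroup.zmultiples v₀) = ℓ := by
      rw [Nat.card_zmultiples, addOrderOf_eq_prime_of_ne_zero (ℓ := ℓ) hv₀]
    have heq : AddSubgroup.zmultiples v₀ = X :=
      AddSubgroup.eq_of_le_of_card_ge hle (hX.trans hcard.ge)
    intro x hx
    rw [← heq] at hx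
    obtain ⟨n, rfl⟩ := AddSubgroup.mem_zmultiples_iff.mp hx
    exact ⟨(n : ZMod ℓ), (Int.cast_smul_eq_zsmul (ZMod ℓ) n v₀).symm⟩

/-- **`#ker f ≤ ℓ` for a non-zero homomorphism on an `𝔽_ℓ`-plane**: the image contains an
element of order `ℓ`, hence has at least `ℓ` elements, and `#A = #ker f · #im f = ℓ²`.
[cite: Serre1972, §1.11 (1)] -/
theorem card_ker_le_of_exists_ne_zero {B : Type*} [AddCommGroup B] (hA : Nat.card A = ℓ ^ 2)
    (f : A →+ B) (hf : ∃ x : A, f x ≠ 0) : Nat.card f.ker ≤ ℓ := by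
  have hp : ℓ.Prime := Fact.out
  haveI : Finite A := Nat.finite_of_card_ne_zero (by rw [hA]; exact pow_ne_zero _ hp.ne_zero)
  obtain ⟨x, hx⟩ := hf
  haveI : Finite f.range := Finite.of_surjective f.rangeRestrict f.rangeRestrict_surjective
  -- `#A = #ker · #range`
  have h1 : Nat.card f.ker * Nat.card f.range = ℓ ^ 2 := by
    rw [← hA, ← f.ker.card_mul_index, AddSubgroup.index_ker]
  -- the image contains `f x`, of order `ℓ`
  have hℓx : ℓ • f x = 0 := by
    rw [← map_nsmul, ← Nat.cast_smul_eq_nsmul (ZMod ℓ), ZMod.natCast_self, zero_smul, map_zero]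
  have hord : addOrderOf (⟨f x, x, rfl⟩ : f.range) = ℓ := by
    rw [← addOrderOf_injective f.range.subtype Subtype.val_injective, AddSubgroup.subtype_apply]
    exact ((Nat.dvd_prime hp).mp (addOrderOf_dvd_of_nsmul_eq_zero hℓx)).resolve_left
      fun h ↦ hx (AddMonoid.addOrderOf_eq_one_iff.mp h)
  have h2 : ℓ ≤ Nat.card f.range := by
    rw [← hord]
    exact Nat.le_of_dvd Nat.card_pos (addOrderOf_dvd_natCard _)
  have h3 : Nat.card f.ker * ℓ ≤ ℓ * ℓ := by
    calc Nat.card f.ker * ℓ ≤ Nat.card f.ker * Nat.card f.range := Nat.mul_le_mul_left _ h2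
      _ = ℓ * ℓ := by rw [h1, sq]
  exact Nat.le_of_mul_le_mul_right h3 hp.pos

/-- **Serre 1972, §1.11 (1), module-theoretic skeleton of the ordinary case.**  Let `A` be an
`𝔽_ℓ`-plane (`#A = ℓ²`; `E[ℓ]`), `f : A → B` a homomorphism ("reduction `E_ℓ → Ẽ(k̄)`") which is
invariant under a family of additive maps `τ_i` of `A` ("the inertia group acts trivially on
`Ẽ(k̄)`", `χ_Y = 1`) and is not identically zero ("height `1`: `Ẽ_ℓ ≠ 0` is hit").  Then there is
`v₀ ≠ 0` ("`X_ℓ = 𝔽_ℓ e₁`") with `τ_i x - x ∈ 𝔽_ℓ v₀` for all `i`, `x` — the ordinary alternative of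
the hypothesis `hF` of `serre_open_image_of_reduction_shape`.
[cite: Serre1972, §1.11 (1), Prop. 11 (proof)] -/
theorem exists_forall_sub_mem_line_of_invariant {B : Type*} [AddCommGroup B]
    (hA : Nat.card A = ℓ ^ 2) (f : A →+ B) {ι : Type*} (τ : ι → A →+ A)
    (hinv : ∀ (i : ι) (x : A), f (τ i x) = f x) (hf : ∃ x : A, f x ≠ 0) :
    ∃ v₀ : A, v₀ ≠ 0 ∧ ∀ (i : ι) (x : A), ∃ b : ZMod ℓ, τ i x - x = b • v₀ := by
  have hp : ℓ.Prime := Fact.out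
  haveI : Finite A := Nat.finite_of_card_ne_zero (by rw [hA]; exact pow_ne_zero _ hp.ne_zero)
  have hne : ∃ a : A, a ≠ 0 := by
    obtain ⟨x, hx⟩ := hf
    exact ⟨x, fun h ↦ hx (by rw [h, map_zero])⟩
  obtain ⟨v₀, hv₀, hX⟩ := exists_forall_eq_smul_of_card_le f.ker
    (card_ker_le_of_exists_ne_zero hA f hf) hne
  refine ⟨v₀, hv₀, fun i x ↦ ?_⟩
  obtain ⟨b, hb⟩ := hX (τ i x - x) (by rw [AddMonoidHom.mem_ker, map_sub, hinv, sub_self])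
  exact ⟨b, hb⟩

end Literature.NumberTheory.EllipticCurves
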